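/-
Copyright (c) 2026 the pub-hodgecm-mathlib formalisation cell (harness21).  Prover seat hodgecm-mathlib-R90-C10-p01 (g3), SLAB R90-TF, section S1 «Ch. 10∕12 local»;
crux H413 = `stmt-HodgeConjecture-24833`; brick (E-4), dealt BY NAME to R90-C10-p01 by R90-C10-plan (g2) in ruling R-S1-13 (2026-09-04T23:29:40Z; pool → taken by
lineage 23:39Z).  KERNEL module: ONE THEOREM (no definition, no named fact, no `sorry`, no instance, no notation).  2026-09-04.
-/
import Summits.HodgeConjecture.HodgeConjecture.Theorems.F0T1aArchRealCaseU21                   -- ★ (A-p06 (g24)): `archCharactersLinIndep_closed_of_letters_u21` — Labesse–Langlands L. 6.1 INSTANTIATED, A6 read at `U(2,1)`; brings ★ A1, ★ A8, ★ (α) `sixClauses_holds`, ★ (β) `archTestKc_package`, ★ (γ)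
import Literature.NumberTheory.Automorphic.UnitaryGroupArchCharacterTraceClassOfKTypeGrowthU21    -- ★ C1′ p831233: `archIntegratedOperatorTraceClass_forall_of_kTypeGrowthU21` (A5 ⇐ V19 at `(2,1)`; V22 in-house ★ p831076)
import Literature.NumberTheory.Automorphic.U21IrreducibleUnitaryKTypeGrowthProofs                 -- ★ (A-p06 (g24)): `kTypeGrowth_uTwoOne` = V19 at `U(2,1)` PROVED IN-HOUSE
import Literature.NumberTheory.Automorphic.HasUnitaryGlobalizationOfInfUnitaryU21                 -- ★ ROAD-GLOB head (A-p14 (g24)): `hasUnitaryGlobalization_of_isInfUnitary_uTwoOne` = A6 at `U(2,1)` PROVED IN-HOUSE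
import Literature.NumberTheory.Automorphic.UnitaryGlobalizationIrreducibleProofs                  -- ★ CAPSTONE (A-p06 (g23)): `unitaryGlobalizationIrreducible_holds` = A7′ PROVED IN-HOUSE
import HarnessLib

/-!
# R90-TF · S1 (Rogawski 1990 Ch. 12, local) — (E-4) `R90S1ExtE3ArchCharLinIndepOfRecord`: row E3.R5 `ExtE3Arch.archCharLinIndep` PAID OUTRIGHT, AS A THEOREMS TWIN

Cell hodgecm-mathlib, slab R90-TF (director brief v2), section S1 «Ch10-local» (base R90-C10), crux h413 = stmt-HodgeConjecture-24833 (lane `--supports … --as helper`),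
route `route-HodgeConjecture-HCCMUnconditional` (no route verbs); prover seat R90-C10-p01 (g3); ruling R-S1-13 of the S1 dealer R90-C10-plan (g2) («=» in advance on
GREEN rc0∕s0∕TRIO + AUDIT CLEAN; auditor R90-C10-audit1).  ONE THEOREM; ★-only imports (NO `Lines` import).

WHAT.  ★ D1 `Theorems/R90S1ClosureE3Defs.lean` (p862727) fields row E3.R5 of the (E3) closure socket «local harmonic analysis» as
`ExtE3Arch.archCharLinIndep : ∀ (L : Type) [Field L] [NumberField L] [IsCMField L] (ι) (H) (T) (hT) (νinf), ArchCharactersLinIndep L ι H T hT νinf` (D1 :347–350) —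
PROPOSITION 13.8.1 of [Rogawski1990] (p. 212) at `S = ∅` for `G′_∞ ∕ K_c`, i.e. the linear independence of the characters of the irreducible unitary representations
of `U(2,1)` pulled back along `archProjUForm`, tested against the bi-`K_c`-invariant archimedean test functions `ArchTestKc` ([LabesseLanglands1979] Lemma 6.1,
[JacquetLanglands1970] Lemma 16.1.1).  That ∀-text is ALREADY PROVED at TRIO in the tree — but inside a LINES file (`Cruxes/H413/Lines/F0_T1a_ArchCharactersLinIndep.lean`
ED. 11, sorry-free: `archCharactersLinIndep_holds` :343 via `archCharactersLinIndep_of_stubs` :307 over eight in-house-closed stubs), which a `Theorems` consumer may not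
import.  This file RE-HOMES the proof as a Theorems twin so that `ExtE3Arch`'s future assembler can consume row E3.R5 BY NAME (R-S1-13).

HOW (the Lines composition transplanted BY NAME, not re-typed).  The F0∕P3b line's own ★ Theorems closer `F0T1aArchRealCaseU21.archCharactersLinIndep_closed_of_letters_u21`
(A-p06 (g24)) IS the composition `archCharactersLinIndep_of_stubs` with the Lines-local `Prop` abbreviations (`ArchRealCase`, `ArchRealReduction`,
`ArchCharactersLinIndepClosed`) inlined and ★ A1 `weightedHilbertSchmidtVanishing_holds` ∕ ★ A8 `archRealReduction` ∕ ★ (α) `sixClauses_holds` ∕ ★ (β)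
`archTestKc_package` ∕ ★ (γ) `archRealCase_of_package_u21` supplied; it leaves exactly the three LETTER binders of ED. 10, which this file feeds with the ★ terms the
Lines stubs' bodies use (the terms, not the stubs): `hTC := archIntegratedOperatorTraceClass_forall_of_kTypeGrowthU21 kTypeGrowth_uTwoOne` (A5 = ★ C1′ ∘ V19 at
`U(2,1)`, = `stub_traceClass` ∘ `stub_V19`), `hGE := hasUnitaryGlobalization_of_isInfUnitary_uTwoOne` (A6 at `U(2,1)`, = `stub_globExists`), `hIR :=
unitaryGlobalizationIrreducible_holds` (A7′, = `stub_globIrreducible`).  Net: zero new mathematics, zero duplicated proof text; axioms TRIO (every input is ★ and TRIO).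

* §1 **`archCharLinIndep_holds`** — THE TYPE OF THE FIELD `ExtE3Arch.archCharLinIndep` (★ D1 :347–350) VERBATIM, proved outright.
* §2 junction certs (zero cost): `example : ⟨D1 :347–350 bytes⟩ := archCharLinIndep_holds` (same bytes, elaborated in THIS file's scope) and the parametrised
  reading `example (L) … (νinf) : ArchCharactersLinIndep L ι H T hT νinf := archCharLinIndep_holds L ι H T hT νinf` (the shape T1b's `stub_archFactor` and the
  Lines head `archCharactersLinIndep_holds` have).  The BY-STRUCTURE junction against ★ D1 (`⟨_, _, _, archCharLinIndep_holds⟩ : ExtE3Arch`) is certified by paste at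
  HOME (`R90/R90-C10-p01/g3/CERT-E4-junction.bypaste.lean`, imports ★ D1) and is the future assembler's one line; it is not placed here so that this file's import
  closure stays the F0∕P3b arch estate only (D1 drags the finite-place carpets).

HONEST LABEL: HC_CM is proved only modulo the 7 printed citations (2 remaining named inputs: hLiu418 = stmt-HodgeConjecture-24832, h413 = stmt-HodgeConjecture-24833)
until rung 0 closes; this file re-homes an already-TRIO proof of ONE conjunct (row E3.R5) of a closure BUILD TARGET and closes NOTHING at rung 0 (rows E3.R1∕R2 of
`ExtE3Arch` stay open); REL ≠ ★ ≠ BUILT.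

## References
* [Rogawski1990] J. D. Rogawski, *Automorphic Representations of Unitary Groups in Three Variables*, Ann. of Math. Stud. 123 (1990), §13.8 Prop. 13.8.1 p. 212
  (held scan book:rogawski1990-automorphic-representations-unitary-groups-three-variables, chunk p0206 = printed p. 212).
* [LabesseLanglands1979] J.-P. Labesse, R. P. Langlands, *L-indistinguishability for SL(2)*, Canad. J. Math. 31 (1979), Lemma 6.1 pp. 768–769.
* [JacquetLanglands1970] H. Jacquet, R. P. Langlands, *Automorphic Forms on GL(2)*, LNM 114 (1970), §16, Lemma 16.1.1 (proof) p. 498.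
* [KnappVogan1995] A. W. Knapp, D. A. Vogan, *Cohomological Induction and Unitary Representations* (1995), Introduction Thms. 0.4, 0.6.
* [Varadarajan1989] V. S. Varadarajan, *An Introduction to Harmonic Analysis on Semisimple Lie Groups*, CSAM 16 (1989), §5.4 Thms. 19, 22.
-/

set_option autoImplicit false
-- the mandated namespace has the single-problem summit's repeated segment (`HodgeConjecture.HodgeConjecture`)
set_option linter.dupNamespace false

noncomputable section

open NumberField MeasureTheory
open scoped Matrix
open Literature.NumberTheory.Rogawski1990
open Literature.NumberTheory.Automorphic Literature.NumberTheory.Automorphic.UnitaryGroup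
open Summit.HodgeConjecture.HodgeConjecture.Cruxes.H413 (F0T1aArchRealCaseU21.archCharactersLinIndep_closed_of_letters_u21)

namespace Summit.HodgeConjecture.HodgeConjecture.R90.S1

/-! ## §1 Row E3.R5 paid outright -/

/-- **(E-4) ROW E3.R5 OF THE (E3) CLOSURE SOCKET, PAID OUTRIGHT — PROPOSITION 13.8.1 AT `S = ∅` FOR `G′_∞ ∕ K_c` AT EVERY CM FRAME.**  For every CM field `L`,
embedding `ι : L →+* ℂ`, Hermitian `H ∈ M₃(L)`, frame `T ∈ GL₃(ℂ)` with `Tᴴ · ι(H) · T = J` (ball model) and Borel measure `νinf` on `G′_∞ = U(H)(L ⊗ ℝ)`: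
★ `Rogawski1990.ArchCharactersLinIndep L ι H T hT νinf` — under its internal guards (`H` definite off `ι`, `νinf` Haar), a coefficient family `a : Cinf → ℂ` supported on
classes with an admissible representative infinitesimally unitary along `𝔭 ⊕ ℝz₀`, whose character sums `∑ a(y) Θ_y(φ)` converge and vanish for every `φ ∈ ArchTestKc`,
is zero.  THE TYPE IS THE FIELD `ExtE3Arch.archCharLinIndep` OF ★ `R90S1ClosureE3Defs` (:347–350) VERBATIM.  Proof: the F0∕P3b line's ★ Theorems closer
`F0T1aArchRealCaseU21.archCharactersLinIndep_closed_of_letters_u21` (Labesse–Langlands' Lemma 6.1 instantiated at the pulled-back unitary globalizations of record and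
`B :=` the operator families of `ArchTestKc`; real∕imaginary parts by ★ A8, both real families killed by the ★ assembly of A1, (α), (β), (γ)) fed with the three
in-house letters: A5 trace class = ★ C1′ `archIntegratedOperatorTraceClass_forall_of_kTypeGrowthU21` ∘ ★ V19-at-`U(2,1)` `kTypeGrowth_uTwoOne`; A6 at `U(2,1)` = ★
`hasUnitaryGlobalization_of_isInfUnitary_uTwoOne`; A7′ = ★ `unitaryGlobalizationIrreducible_holds` — exactly the terms the sorry-free Lines file
`F0_T1a_ArchCharactersLinIndep` ED. 11 closes its stubs with (its head `archCharactersLinIndep_holds` :343 has this type, binders uncurried).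
[cite: Rogawski1990, Prop. 13.8.1 p. 212] [cite: LabesseLanglands1979, Lemma 6.1 pp. 768–769] [cite: JacquetLanglands1970, Lemma 16.1.1 (proof) p. 498] -/
theorem archCharLinIndep_holds : ∀ (L : Type) [Field L] [NumberField L] [IsCMField L] (ι : L →+* ℂ) (H : Matrix (Fin 3) (Fin 3) L) (T : GL (Fin 3) ℂ)
    (hT : (T : Matrix (Fin 3) (Fin 3) ℂ)ᴴ * H.map ι * (T : Matrix (Fin 3) (Fin 3) ℂ) = Literature.Geometry.ComplexHyperbolic.BallModel.J)
    (νinf : @Measure (UnitaryGroup.arch (↥(maximalRealSubfield L)) L (IsCMField.complexConj L) 3 H) (borel _)),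
    ArchCharactersLinIndep L ι H T hT νinf :=
  F0T1aArchRealCaseU21.archCharactersLinIndep_closed_of_letters_u21
    (archIntegratedOperatorTraceClass_forall_of_kTypeGrowthU21 kTypeGrowth_uTwoOne)   -- A5 := ★ C1′ ∘ ★ V19 at `U(2,1)` (= `stub_traceClass` ∘ `stub_V19`)
    hasUnitaryGlobalization_of_isInfUnitary_uTwoOne                                  -- A6 at `U(2,1)` (= `stub_globExists`, ★ ROAD-GLOB head)
    unitaryGlobalizationIrreducible_holds                                            -- A7′ (= `stub_globIrreducible`, ★ CAPSTONE)

/-! ## §2 Junction certs (elaboration guards; no content) -/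

/-- junction (i): the field type of `ExtE3Arch.archCharLinIndep` (★ D1 `R90S1ClosureE3Defs` :347–350), same bytes, elaborated in this file's scope. -/
example : ∀ (L : Type) [Field L] [NumberField L] [IsCMField L] (ι : L →+* ℂ) (H : Matrix (Fin 3) (Fin 3) L) (T : GL (Fin 3) ℂ)
    (hT : (T : Matrix (Fin 3) (Fin 3) ℂ)ᴴ * H.map ι * (T : Matrix (Fin 3) (Fin 3) ℂ) = Literature.Geometry.ComplexHyperbolic.BallModel.J)
    (νinf : @Measure (UnitaryGroup.arch (↥(maximalRealSubfield L)) L (IsCMField.complexConj L) 3 H) (borel _)),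
    ArchCharactersLinIndep L ι H T hT νinf :=
  archCharLinIndep_holds

/-- junction (ii): the parametrised reading at one frame (the shape of the Lines head `F0T1aArchCharactersLinIndep.archCharactersLinIndep_holds` and of T1b's
`stub_archFactor`). -/
example (L : Type) [Field L] [NumberField L] [IsCMField L] (ι : L →+* ℂ) (H : Matrix (Fin 3) (Fin 3) L) (T : GL (Fin 3) ℂ)
    (hT : (T : Matrix (Fin 3) (Fin 3) ℂ)ᴴ * H.map ι * (T : Matrix (Fin 3) (Fin 3) ℂ) = Literature.Geometry.ComplexHyperbolic.BallModel.J)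
    (νinf : @Measure (UnitaryGroup.arch (↥(maximalRealSubfield L)) L (IsCMField.complexConj L) 3 H) (borel _)) :
    ArchCharactersLinIndep L ι H T hT νinf :=
  archCharLinIndep_holds L ι H T hT νinf

end Summit.HodgeConjecture.HodgeConjecture.R90.S1

end
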